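import Literature.NumberTheory.PAdicHodge.CMFibreCellsGoodSupersingularData
import Literature.NumberTheory.PAdicHodge.UnitRootPeriodWitt
import Literature.NumberTheory.EllipticCurves.HasseInvariantTraceProofs
import HarnessLib

/-!
# The CM fibres `E₀ ∈ {y² = x³ + a x, y² = x³ + b}` of the K★ cell models: good ORDINARY data at `p ∈ {5, 7}` for the three
# (G)-ordinary starred cells (`A_p(E₀ mod p) ≠ 0`, `p ∤ a_p(E₀)`, `a_p(E₀)² < 4p`, `p ∤ Δ(E₀)`)

Topic `Literature/NumberTheory/PAdicHodge`; namespace `Literature.NumberTheory.PAdicHodge`. THEOREMS ONLY (no definition, no named fact, no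
instance, no `sorry`). ORDINARY twin of `CMFibreCellsGoodSupersingularData`: the special fibre of the cell model
`W_D = ⟨0,0,0,a ϱ^{r₄}, b ϱ^{r₆}⟩` at `ϱ = 0` is the `ℤ`-curve `E₀ = ⟨0, 0, 0, (r₄ = 0 ? a : 0), (r₆ = 0 ? b : 0)⟩`
(`AinfRamifiedDivisionTransport.map_explicitModel_eq_map_cmFibre`). On the three (G)-ORDINARY starred cells of crux K★ — `(5; III*)`
(`ord₅ Δ_min = 9`, numerology `(e; r₄, r₆; t₄, t₆) = (4; 0, 2; 0, 1)`), `(7; IV*)` (`(3; 1, 0; 1, 0)`), `(7; II*)` (`(6; 4, 0; 2, 0)`), i.e.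
`(p; r₄, r₆) ∈ {(5; 0, >0), (7; >0, 0)}` — this is `y² = x³ + a x` (`j = 1728`, ORDINARY at `5 ≡ 1 (4)`) resp. `y² = x³ + b` (`j = 0`,
ORDINARY at `7 ≡ 1 (3)`). This file provides the `E₀`-hypotheses of the ordinary (unit-root) frame of Kato's reciprocity law
(`UnitRootFramePeriods`, `FrobeniusUnitRoot.exists_unitRoot_frobeniusPoly`, `UnitRootPeriodWitt.unitRoot_pow_ne_one`) for them:

* ★ `hasseCoeff_cmFibre_ne_zero` — `A_p(E₀ mod p) ≠ 0` (`A_5(y² = x³ + āx) = 32ā`, `A_7(y² = x³ + b̄) = 192b̄`, `hasseCoeff_five/seven_short`);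
* ★ `not_dvd_Δ_cmFibre_ord` — `p ∤ Δ(E₀)` from `p ∤ a` (at `5`, `Δ = −64a³`) / `p ∤ b` (at `7`, `Δ = −432b²`); `not_dvd_of_isUnit_cells_ord`
  derives these from the cells' unit `64a³p^{t₄} + 432b²p^{t₆} ∈ ℤ_pˣ` (`t₄ = 0 < t₆` at `5`, `t₄ > 0 = t₆` at `7`);
* ★ `not_dvd_tr_cmFibre` — `p ∤ a_p(E₀)` (`A_p ≡ a_p`, `hasseCoeff_eq_zero_iff_dvd_tr`), `norm_intCast_tr_cmFibre_eq_one` — `‖a_p‖_p = 1` (the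
  hypothesis of `exists_unitRoot_frobeniusPoly`), ★ `tr_cmFibre_sq_lt_four_mul` — `a_p² < 4p` (Hasse–Manin `sq_le_four_mul`, strict for a prime;
  the hypothesis of `unitRoot_pow_ne_one`).

The ellipticity instances `isElliptic_cmFibre_map_field/zmod`, `isElliptic_curveOver_cmFibre` of the supersingular file are generic in `E₀` and are
reused as they are. Purpose: crux K★ `stmt-BirchSwinnertonDyer-22226` (route `EdixhovenFibreFiveSeven`, line `kato_lever`, stub
`stub_localFormulaOrdinaryCells`), memo `Summits/…/Cruxes/StarredOptimalManinUnitFiveSeven/Lines/kato-lever-seam-rec-at-cells.md` §16–§17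
(«cells … with `hA₀` replaced by `p ∤ a_p(E₀)`»). Infrastructure only; BSD / K★ are not proved by this.

## References
* J. H. Silverman, *AEC* (2009), III.1, V.1.1 (Hasse), V.4.1 (Deuring's criterion), Ex. V.4.4–4.5 (`j = 0, 1728`), Ex. V.5.10. [SilvermanAEC2009]
-/

noncomputable section

open scoped Classical
open Polynomial

namespace Literature.NumberTheory.PAdicHodge

open Literature.NumberTheory.EllipticCurves

section CMFibre

variable {p : ℕ} [hp : Fact p.Prime] (a b : ℤ) (r₄ r₆ : ℕ)

/-- ★ **`A_p(E₀ mod p) ≠ 0`** on the three (G)-ordinary cells: `A_5(y² = x³ + ā x) = 32 ā ≠ 0` (`5 ∤ a`), `A_7(y² = x³ + b̄) = 192 b̄ ≠ 0`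
(`7 ∤ b`) (Deuring). [cite: SilvermanAEC2009, V.4.1 and Ex. V.4.4–4.5] -/
theorem hasseCoeff_cmFibre_ne_zero (hp57 : p = 5 ∨ p = 7) (hr₄ : p = 5 → r₄ = 0) (hr₆ : p = 7 → r₆ = 0)
    (ha : p = 5 → ¬ (p : ℤ) ∣ a) (hb : p = 7 → ¬ (p : ℤ) ∣ b) :
    ((⟨0, 0, 0, if r₄ = 0 then a else 0, if r₆ = 0 then b else 0⟩ : WeierstrassCurve ℤ).map (Int.castRingHom (ZMod p))).hasseCoeff p ≠ 0 := by
  rw [map_cmFibre]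
  rcases hp57 with rfl | rfl
  · rw [hasseCoeff_five_short, if_pos (hr₄ rfl), eq_intCast]
    have h32 : (32 : ZMod 5) * (a : ZMod 5) = ((32 * a : ℤ) : ZMod 5) := by push_cast; ring
    rw [h32, Ne, ZMod.intCast_zmod_eq_zero_iff_dvd]
    intro h
    have h5 : Prime ((5 : ℕ) : ℤ) := Nat.prime_iff_prime_int.mp (by norm_num)
    rcases h5.dvd_or_dvd h with h' | h'
    · norm_num at h'
    · exact ha rfl h'
  · rw [hasseCoeff_seven_short, if_pos (hr₆ rfl), eq_intCast]
    have h192 : (192 : ZMod 7) * (b : ZMod 7) = ((192 * b : ℤ) : ZMod 7) := by push_cast; ring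
    rw [h192, Ne, ZMod.intCast_zmod_eq_zero_iff_dvd]
    intro h
    have h7 : Prime ((7 : ℕ) : ℤ) := Nat.prime_iff_prime_int.mp (by norm_num)
    rcases h7.dvd_or_dvd h with h' | h'
    · norm_num at h'
    · exact hb rfl h'

/-- ★ **`p ∤ Δ(E₀)`** on the ordinary cells: at `5` from `5 ∤ a` (`E₀ = y² = x³ + a x`, `Δ = −64a³`, `5 ∤ 64`), at `7` from `7 ∤ b`
(`E₀ = y² = x³ + b`, `Δ = −432b²`, `7 ∤ 432`). [cite: SilvermanAEC2009, III.1 and VII.5] -/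
theorem not_dvd_Δ_cmFibre_ord (hp57 : p = 5 ∨ p = 7) (hr : (p = 5 → r₄ = 0 ∧ 0 < r₆) ∧ (p = 7 → 0 < r₄ ∧ r₆ = 0))
    (ha : p = 5 → ¬ (p : ℤ) ∣ a) (hb : p = 7 → ¬ (p : ℤ) ∣ b) :
    ¬ (p : ℤ) ∣ ((⟨0, 0, 0, if r₄ = 0 then a else 0, if r₆ = 0 then b else 0⟩ : WeierstrassCurve ℤ)).Δ := by
  rcases hp57 with rfl | rfl
  · obtain ⟨h₄, h₆⟩ := hr.1 rfl
    rw [Δ_cmFibre_seven a b r₄ r₆ h₄ h₆, dvd_neg]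
    intro h
    have h5 : Prime ((5 : ℕ) : ℤ) := Nat.prime_iff_prime_int.mp (by norm_num)
    rcases h5.dvd_or_dvd h with h' | h'
    · norm_num at h'
    · exact ha rfl (h5.dvd_of_dvd_pow h')
  · obtain ⟨h₄, h₆⟩ := hr.2 rfl
    rw [Δ_cmFibre_five a b r₄ r₆ h₄ h₆, dvd_neg]
    intro h
    have h7 : Prime ((7 : ℕ) : ℤ) := Nat.prime_iff_prime_int.mp (by norm_num)
    rcases h7.dvd_or_dvd h with h' | h'
    · norm_num at h'
    · exact hb rfl (h7.dvd_of_dvd_pow h')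

/-- **`5 ∤ a` at `5`, `7 ∤ b` at `7` from the cells' unit `64a³p^{t₄} + 432b²p^{t₆} ∈ ℤ_pˣ`** on the ordinary cells (`t₄ = 0 < t₆` at `5`: the
unit is `≡ 64 a³`; `t₄ > 0 = t₆` at `7`: `≡ 432 b²`). [cite: SilvermanAEC2009, VII.5.5] -/
theorem not_dvd_of_isUnit_cells_ord (hp57 : p = 5 ∨ p = 7) {t₄ t₆ : ℕ} (ht : (p = 5 → t₄ = 0 ∧ 0 < t₆) ∧ (p = 7 → 0 < t₄ ∧ t₆ = 0))
    (hu : IsUnit (64 * (a : ℤ_[p]) ^ 3 * (p : ℤ_[p]) ^ t₄ + 432 * (b : ℤ_[p]) ^ 2 * (p : ℤ_[p]) ^ t₆)) :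
    (p = 5 → ¬ (p : ℤ) ∣ a) ∧ (p = 7 → ¬ (p : ℤ) ∣ b) := by
  -- a unit of `ℤ_p` is not in `pℤ_p`; a sum `x + y` with `y ∈ pℤ_p` is a unit iff `x` is
  have key : ∀ (x y : ℤ_[p]), IsUnit (x + (p : ℤ_[p]) * y) → IsUnit x := fun x y h => by
    by_contra hx
    have hxm : x ∈ IsLocalRing.maximalIdeal ℤ_[p] := (IsLocalRing.mem_maximalIdeal _).2 hx
    have hym : (p : ℤ_[p]) * y ∈ IsLocalRing.maximalIdeal ℤ_[p] := by
      rw [PadicInt.maximalIdeal_eq_span_p]; exact Ideal.mul_mem_right _ _ (Ideal.mem_span_singleton_self _)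
    exact (IsLocalRing.mem_maximalIdeal _).1 (Ideal.add_mem _ hxm hym) h
  have hint : ∀ (n : ℤ) (k : ℕ) (c : ℤ_[p]), IsUnit ((c * (n : ℤ_[p]) ^ k)) → 0 < k → ¬ (p : ℤ) ∣ n := fun n k c h hk hdvd => by
    have hn : ¬ IsUnit ((n : ℤ_[p])) := fun hu' => by
      have := PadicInt.isUnit_iff.1 hu'
      exact absurd this (ne_of_lt ((PadicInt.norm_int_lt_one_iff_dvd n).2 hdvd))
    exact hn (isUnit_of_dvd_unit (dvd_mul_of_dvd_right (dvd_pow_self _ hk.ne') _) h)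
  rcases hp57 with rfl | rfl
  · obtain ⟨h₄, h₆⟩ := ht.1 rfl
    refine ⟨fun _ => ?_, fun h => by norm_num at h⟩
    rw [h₄, pow_zero, mul_one] at hu
    obtain ⟨t, rfl⟩ : ∃ t, t₆ = t + 1 := ⟨t₆ - 1, by omega⟩
    have hu' : IsUnit (64 * (a : ℤ_[5]) ^ 3 + ((5 : ℕ) : ℤ_[5]) * (432 * (b : ℤ_[5]) ^ 2 * ((5 : ℕ) : ℤ_[5]) ^ t)) := by
      convert hu using 1; ring
    exact hint a 3 64 (key _ _ hu') three_pos
  · obtain ⟨h₄, h₆⟩ := ht.2 rfl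
    refine ⟨fun h => by norm_num at h, fun _ => ?_⟩
    rw [h₆, pow_zero, mul_one] at hu
    obtain ⟨t, rfl⟩ : ∃ t, t₄ = t + 1 := ⟨t₄ - 1, by omega⟩
    have hu' : IsUnit (432 * (b : ℤ_[7]) ^ 2 + ((7 : ℕ) : ℤ_[7]) * (64 * (a : ℤ_[7]) ^ 3 * ((7 : ℕ) : ℤ_[7]) ^ t)) := by
      convert hu using 1; ring
    exact hint b 2 432 (key _ _ hu') two_pos

/-- ★ **`p ∤ a_p(E₀)`** on the ordinary cells (`a_p = p + 1 − #E₀(𝔽_p)`, the tree's `HasseManin.tr`): `A_p ≡ a_p (mod p)`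
(`hasseCoeff_eq_zero_iff_dvd_tr`) and `A_p(E₀ mod p) ≠ 0`. [cite: SilvermanAEC2009, Thm. V.4.1(a) and Ex. V.5.10] -/
theorem not_dvd_tr_cmFibre (hp57 : p = 5 ∨ p = 7) (hr : (p = 5 → r₄ = 0 ∧ 0 < r₆) ∧ (p = 7 → 0 < r₄ ∧ r₆ = 0))
    (ha : p = 5 → ¬ (p : ℤ) ∣ a) (hb : p = 7 → ¬ (p : ℤ) ∣ b) :
    ¬ (p : ℤ) ∣ HasseManin.tr
      ((⟨0, 0, 0, if r₄ = 0 then a else 0, if r₆ = 0 then b else 0⟩ : WeierstrassCurve ℤ).map (Int.castRingHom (ZMod p))) := by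
  haveI := isElliptic_cmFibre_map_zmod (p := p) _ (not_dvd_Δ_cmFibre_ord a b r₄ r₆ hp57 hr ha hb)
  have hp2 : p ≠ 2 := by rcases hp57 with rfl | rfl <;> norm_num
  rw [← WeierstrassCurve.hasseCoeff_eq_zero_iff_dvd_tr _ hp2]
  exact hasseCoeff_cmFibre_ne_zero a b r₄ r₆ hp57 (fun h => (hr.1 h).1) (fun h => (hr.2 h).2) ha hb

/-- **`‖a_p(E₀)‖_p = 1`** on the ordinary cells — the hypothesis of `FrobeniusUnitRoot.exists_unitRoot_frobeniusPoly` (the unit root `α` of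
`X² − a_pX + p`). [cite: SilvermanAEC2009, Thm. V.4.1(a)] -/
theorem norm_intCast_tr_cmFibre_eq_one (hp57 : p = 5 ∨ p = 7) (hr : (p = 5 → r₄ = 0 ∧ 0 < r₆) ∧ (p = 7 → 0 < r₄ ∧ r₆ = 0))
    (ha : p = 5 → ¬ (p : ℤ) ∣ a) (hb : p = 7 → ¬ (p : ℤ) ∣ b) :
    ‖((HasseManin.tr ((⟨0, 0, 0, if r₄ = 0 then a else 0, if r₆ = 0 then b else 0⟩ : WeierstrassCurve ℤ).map
        (Int.castRingHom (ZMod p))) : ℤ) : ℤ_[p])‖ = 1 := by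
  have h := not_dvd_tr_cmFibre a b r₄ r₆ hp57 hr ha hb
  refine le_antisymm (PadicInt.norm_le_one _) ?_
  by_contra hlt
  exact h ((PadicInt.norm_int_lt_one_iff_dvd _).1 (not_le.1 hlt))

/-- ★ **`a_p(E₀)² < 4p`** on the ordinary cells (Hasse–Manin `a² ≤ 4q`, strict because `4p` is not a square) — the hypothesis of
`UnitRootPeriodWitt.unitRoot_pow_ne_one` (the unit root is not a root of unity). [cite: SilvermanAEC2009, Thm. V.1.1] -/
theorem tr_cmFibre_sq_lt_four_mul (hp57 : p = 5 ∨ p = 7) (hr : (p = 5 → r₄ = 0 ∧ 0 < r₆) ∧ (p = 7 → 0 < r₄ ∧ r₆ = 0))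
    (ha : p = 5 → ¬ (p : ℤ) ∣ a) (hb : p = 7 → ¬ (p : ℤ) ∣ b) :
    HasseManin.tr ((⟨0, 0, 0, if r₄ = 0 then a else 0, if r₆ = 0 then b else 0⟩ : WeierstrassCurve ℤ).map (Int.castRingHom (ZMod p))) ^ 2 <
      4 * p := by
  set E := ((⟨0, 0, 0, if r₄ = 0 then a else 0, if r₆ = 0 then b else 0⟩ : WeierstrassCurve ℤ).map (Int.castRingHom (ZMod p))) with hE
  haveI : E.IsElliptic := isElliptic_cmFibre_map_zmod (p := p) _ (not_dvd_Δ_cmFibre_ord a b r₄ r₆ hp57 hr ha hb)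
  have hsq : HasseManin.tr E ^ 2 ≤ 4 * (Fintype.card (ZMod p) : ℤ) :=
    HasseManin.sq_le_four_mul (fun n => HasseManin.dg_nonneg E n) (fun n hn => HasseManin.dg_succ_eq_one_of_dg_eq_zero E hn)
  rw [ZMod.card] at hsq
  exact sq_lt_four_mul_of_sq_le hp.out hsq

end CMFibre

end Literature.NumberTheory.PAdicHodge

end
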